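import Literature.AlgebraicGeometry.ShimuraVarieties.KudlaRapoport2013.Sec14CaseNTwo
import Literature.NumberTheory.ComplexMultiplication.ReflexNormIdeal
import Mathlib.NumberTheory.NumberField.FractionalIdeal
import Mathlib.LinearAlgebra.BilinearForm.Properties
import HarnessLib

/-!
# [KudlaRapoport2013, §14 (arXiv v2 p. 51)] «an `O_k`-antilinear isomorphism `𝔡⁻¹𝔞 ⥲ 𝔞^∨`,
# `a ↦ N(𝔞)⁻¹ (·, a)_k`» — DISCHARGED: `KR2013_14_dualIso_holds`

Kernel-lane companion of the statement carpet ★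
`Literature/AlgebraicGeometry/ShimuraVarieties/KudlaRapoport2013/Sec14CaseNTwo.lean`: its CLOSED named fact ★
`KR2013_14_dualIso` — S. Kudla, M. Rapoport, *Special cycles on unitary Shimura varieties II: global theory*, J. reine
angew. Math. 697 (2014) 91–157 = arXiv:0912.3758v2, §14 p. 51: «Note that there is an `O_k`-antilinear isomorphism
`𝔡⁻¹𝔞 ⥲ 𝔞^∨`, `a ↦ N(𝔞)⁻¹ (·, a)_k`, where `(x, y)_k = tr(x y^σ)` is the trace form of `k/ℚ`, and `𝔡⁻¹` is the inverse
different», typed for an invertible fractional ideal `𝔞` of the imaginary-quadratic `k` with Mathlib's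
`FractionalIdeal.dual ℤ ℚ 1` (= `𝔡⁻¹`), `FractionalIdeal.absNorm` (= `N`), `Algebra.trace ℚ k` and ★ `conj ℚ k` (= `σ`):
(i) `N(𝔞)⁻¹ tr(x a^σ) ∈ ℤ` for `a ∈ 𝔡⁻¹𝔞`, `x ∈ 𝔞`; (ii) every `ℤ`-linear `f : 𝔞 → ℤ` is `x ↦ N(𝔞)⁻¹ tr(x a^σ)` for a
unique `a ∈ 𝔡⁻¹𝔞` — is PROVED here.  THEOREMS ONLY (no definition, no named fact, no `sorry`, no instance, no
notation); cell hodgecm-mathlib, seat B-typ01 (g32); net debt −1.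

## The proof

KR state this as a «Note» without proof; we formalize the standard argument.
* `𝔡⁻¹𝔞 = (𝔞⁻¹)^∨` is Mathlib's `FractionalIdeal.dual_inv` (`dual ℤ ℚ 𝔞⁻¹ = dual ℤ ℚ 1 · 𝔞`), and `b ∈ I^∨ ⟺ tr(b I) ⊆ ℤ`
  is `FractionalIdeal.mem_dual`.
* The one arithmetic input is the quadratic-field identity **`σ(𝔞) · 𝔞 = N(𝔞) 𝓞_k`** for FRACTIONAL `𝔞`.  For an
  integral ideal `J` this is the tree's ★ `Literature.NumberTheory.ComplexMultiplication.prod_map_eq_span_absNorm`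
  (`∏_{ψ : k → k} ψ(J)𝓞_k = N(J)𝓞_k`, Shimura 1998 §8.3 / Neukirch I (2.6)) with `Hom_ℚ(k, k) = {1, σ}`
  (`KR14dual.univ_algHom`, `KR14dual.mul_map_conj_eq_span_absNorm`); for `𝔞 = d⁻¹ J` (`d = den 𝔞`, `J = num 𝔞`,
  Mathlib `FractionalIdeal.den_mul_self_eq_num'`) and `N(𝔞) = N(J)/|N(d)|` (`FractionalIdeal.absNorm_eq`),
  `d σ(d) = N(d)` (`Algebra.norm_eq_prod_automorphisms`) it yields the two elementwise consequences actually used: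
  **(P1)** `N(𝔞)⁻¹ σ(x) y ∈ 𝓞_k` for `x, y ∈ 𝔞` (`KR14dual.exists_int_eq_absNorm_inv_mul`) and
  **(P2)** `N(𝔞) σ(y) ∈ 𝔞` for `y ∈ 𝔞⁻¹` (`KR14dual.absNorm_mul_conj_mem`, by `Submodule.mul_induction_on` over
  `J σ(J) ∋ N(J)`).
* (i): `N⁻¹ tr(x a^σ) = tr(a · N⁻¹σ(x))` (`tr ∘ σ = tr`, `σ² = 1`) and `N⁻¹ σ(x) ∈ 𝔞⁻¹` by (P1), so `a ∈ (𝔞⁻¹)^∨` gives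
  integrality.
* (ii): extend `f` to the `ℚ`-linear functional `φ` on `k = ℚ ⊗ 𝔞` through Mathlib's `basisOfFractionalIdeal`
  (a `ℚ`-basis of `k` which is a `ℤ`-basis of `𝔞`); by non-degeneracy of the trace form (`traceForm_nondegenerate`,
  `LinearMap.BilinForm.toDual`) `φ = tr(c₀ ·)` for a unique `c₀`; then `a := N(𝔞) σ(c₀)` represents `f`, lies in
  `(𝔞⁻¹)^∨` by (P2) (`tr(a y) = φ(N σ(y)) = f(N σ(y)) ∈ ℤ`), and any representing `a'` has `N⁻¹ σ(a') = c₀` by the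
  same non-degeneracy (evaluate on the basis), whence `a' = a`.

## References
* [KudlaRapoport2013] S. Kudla, M. Rapoport, *Special cycles on unitary Shimura varieties II: global theory*, J. reine
  angew. Math. 697 (2014) 91–157; arXiv:0912.3758v2, §14 (p. 51).
* [NeukirchANT1999] J. Neukirch, *Algebraic Number Theory*, Ch. I Prop. (2.6) (iii) (`𝔞 σ(𝔞) = (N𝔞)` in a quadratic
  field), Ch. III §2 (the inverse different as the trace dual of `𝓞_k`, `(𝔞⁻¹)^∨ = 𝔡⁻¹𝔞`).
* [Shimura1998] G. Shimura, *Abelian Varieties with Complex Multiplication and Modular Functions*, §8.3 Prop. 29 (proof)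
  — the tree's source for `prod_map_eq_span_absNorm`.

ED. 2 (B-typ03 (g34), 2026-09-04): the quadratic-field lemmas (P1) `KR14dual.exists_int_eq_absNorm_inv_mul` and (P2)
`KR14dual.absNorm_mul_conj_mem` are now PUBLIC (cited [NeukirchANT1999, I (2.6) (iii)]), for reuse by the rank-one lattices
`L_{0,𝔞}` of KR (3.1) (`Sec3IdealLatticesHolds`); statements and proofs unchanged.
-/

set_option autoImplicit false

noncomputable section

open NumberField Module
open scoped nonZeroDivisors Pointwise

namespace Literature.AlgebraicGeometry.ShimuraVarieties.KudlaRapoport2013.Sec14CaseNTwo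

open Literature.NumberTheory.Automorphic.Liu2021.AppendixC (conj conj_apply conj_ne_one)
open Literature.NumberTheory.ComplexMultiplication (prod_map_eq_span_absNorm)

namespace KR14dual

variable {k : Type} [Field k] [NumberField k] [IsTotallyComplex k] [Algebra.IsQuadraticExtension ℚ k]

/-- `σ² = 1` (`σ` = complex conjugation of the CM field `k`). [folklore] -/
private theorem conj_conj (x : k) : conj ℚ k (conj ℚ k x) = x := by
  letI : IsCMField k := IsCMField.ofCMExtension ℚ k
  rw [conj_apply, conj_apply]
  exact IsCMField.complexConj_apply_apply (K := k) x

/-- `id ≠ σ` as `ℚ`-algebra maps `k → k`. [folklore] -/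
private theorem id_ne_conj : AlgHom.id ℚ k ≠ ((conj ℚ k : k ≃ₐ[ℚ] k) : k →ₐ[ℚ] k) := by
  intro h
  apply conj_ne_one ℚ k
  ext x
  have := congrArg (fun f : k →ₐ[ℚ] k => f x) h
  simpa using this.symm

open scoped Classical in
/-- `Hom_ℚ(k, k) = {1, σ}` for the quadratic field `k`. [folklore] -/
private theorem univ_algHom :
    (Finset.univ : Finset (k →ₐ[ℚ] k)) = {AlgHom.id ℚ k, ((conj ℚ k : k ≃ₐ[ℚ] k) : k →ₐ[ℚ] k)} := by
  symm
  apply Finset.eq_of_subset_of_card_le (Finset.subset_univ _)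
  rw [Finset.card_pair id_ne_conj, Finset.card_univ,
    ← Fintype.card_congr (Algebra.IsAlgebraic.algEquivEquivAlgHom ℚ k).toEquiv,
    ← Nat.card_eq_fintype_card, IsGalois.card_aut_eq_finrank, Algebra.IsQuadraticExtension.finrank_eq_two]

open scoped Classical in
/-- `Gal(k/ℚ) = {1, σ}` for the quadratic field `k`. [folklore] -/
private theorem univ_algEquiv : (Finset.univ : Finset (k ≃ₐ[ℚ] k)) = {1, conj ℚ k} := by
  symm
  apply Finset.eq_of_subset_of_card_le (Finset.subset_univ _)
  rw [Finset.card_pair (conj_ne_one ℚ k).symm, Finset.card_univ, ← Nat.card_eq_fintype_card,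
    IsGalois.card_aut_eq_finrank, Algebra.IsQuadraticExtension.finrank_eq_two]

/-- `x · σ(x) = N_{k/ℚ}(x)` in the quadratic field `k`. [cite: NeukirchANT1999, Ch. I §2 Prop. (2.6) (ii)] -/
theorem mul_conj_eq_norm (x : k) : x * conj ℚ k x = algebraMap ℚ k (Algebra.norm ℚ x) := by
  classical
  rw [Algebra.norm_eq_prod_automorphisms, univ_algEquiv, Finset.prod_pair (conj_ne_one ℚ k).symm,
    AlgEquiv.one_apply]

/-- `Tr(σ x) = Tr(x)`. [folklore] -/
private theorem trace_conj (x : k) : Algebra.trace ℚ k (conj ℚ k x) = Algebra.trace ℚ k x :=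
  Algebra.trace_eq_of_algEquiv (conj ℚ k) x

/-- **`J · σ(J) = N(J) 𝓞_k`** for an integral ideal `J` of the quadratic field `k` — the tree's ★ `prod_map_eq_span_absNorm`
(`∏_{ψ : k → k} ψ(J) 𝓞_k = N(J) 𝓞_k`) read over `Hom_ℚ(k, k) = {1, σ}`. [cite: NeukirchANT1999, Ch. I §2 Prop. (2.6) (iii)] -/
theorem mul_map_conj_eq_span_absNorm (J : Ideal (𝓞 k)) :
    J * J.map (RingOfIntegers.mapRingHom (((conj ℚ k : k ≃ₐ[ℚ] k) : k →ₐ[ℚ] k) : k →+* k)) =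
      Ideal.span {((Ideal.absNorm J : ℕ) : 𝓞 k)} := by
  classical
  rw [← prod_map_eq_span_absNorm (AlgHom.id ℚ k) J, univ_algHom, Finset.prod_pair id_ne_conj]
  congr 1
  have : RingOfIntegers.mapRingHom ((AlgHom.id ℚ k : k →ₐ[ℚ] k) : k →+* k) = RingHom.id (𝓞 k) :=
    RingHom.ext fun x => RingOfIntegers.ext (by simp)
  rw [this, Ideal.map_id]

/-! ### Numerator–denominator bookkeeping for a fractional ideal (any number field) -/

omit [IsTotallyComplex k] [Algebra.IsQuadraticExtension ℚ k] in
/-- `x ∈ 𝔞 ⇒ d·x ∈ J` for `J = num 𝔞`, `d = den 𝔞`. [folklore] -/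
private theorem exists_num_of_mem (I : FractionalIdeal (𝓞 k)⁰ k) {x : k} (hx : x ∈ I) :
    ∃ j ∈ I.num, (j : k) = ((I.den : 𝓞 k) : k) * x := by
  have h : ((I.den : 𝓞 k) : k) * x ∈ ((FractionalIdeal.num I : Ideal (𝓞 k)) : FractionalIdeal (𝓞 k)⁰ k) := by
    rw [← FractionalIdeal.den_mul_self_eq_num' (𝓞 k)⁰ k I, FractionalIdeal.mem_singleton_mul]
    exact ⟨x, hx, rfl⟩
  obtain ⟨j, hj, hjx⟩ := (FractionalIdeal.mem_coeIdeal _).mp h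
  exact ⟨j, hj, hjx⟩

omit [IsTotallyComplex k] [Algebra.IsQuadraticExtension ℚ k] in
/-- `j ∈ J ⇒ j = d·x` for some `x ∈ 𝔞`. [folklore] -/
private theorem exists_mem_of_num (I : FractionalIdeal (𝓞 k)⁰ k) {j : 𝓞 k} (hj : j ∈ I.num) :
    ∃ x ∈ I, (j : k) = ((I.den : 𝓞 k) : k) * x := by
  have h : (j : k) ∈ ((FractionalIdeal.num I : Ideal (𝓞 k)) : FractionalIdeal (𝓞 k)⁰ k) :=
    (FractionalIdeal.mem_coeIdeal _).mpr ⟨j, hj, rfl⟩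
  rw [← FractionalIdeal.den_mul_self_eq_num' (𝓞 k)⁰ k I, FractionalIdeal.mem_singleton_mul] at h
  obtain ⟨x, hx, hjx⟩ := h
  exact ⟨x, hx, hjx⟩

/-- The norm bookkeeping: `N(𝔞) · d σ(d) = ε · N(J)` with `ε = ±1` (`d = den 𝔞`, `J = num 𝔞`;
`N(𝔞) = N(J)/|N(d)|`, `d σ(d) = N(d)`). [folklore] -/
private theorem absNorm_mul_den_mul_conj_den (𝔞 : (FractionalIdeal (𝓞 k)⁰ k)ˣ) :
    ∃ ε : ℤ, (ε = 1 ∨ ε = -1) ∧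
      algebraMap ℚ k (FractionalIdeal.absNorm (𝔞 : FractionalIdeal (𝓞 k)⁰ k)) *
          ((((𝔞 : FractionalIdeal (𝓞 k)⁰ k).den : 𝓞 k) : k) *
            conj ℚ k (((𝔞 : FractionalIdeal (𝓞 k)⁰ k).den : 𝓞 k) : k)) =
        ε * ((Ideal.absNorm (𝔞 : FractionalIdeal (𝓞 k)⁰ k).num : ℕ) : k) := by
  set I : FractionalIdeal (𝓞 k)⁰ k := (𝔞 : FractionalIdeal (𝓞 k)⁰ k) with hI
  have hd0 : (I.den : 𝓞 k) ≠ 0 := nonZeroDivisors.coe_ne_zero I.den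
  have hm0 : Algebra.norm ℤ (I.den : 𝓞 k) ≠ 0 := Algebra.norm_ne_zero_iff.mpr hd0
  have hdd : ((I.den : 𝓞 k) : k) * conj ℚ k ((I.den : 𝓞 k) : k) =
      ((Algebra.norm ℤ (I.den : 𝓞 k) : ℤ) : k) := by
    rw [mul_conj_eq_norm, ← Algebra.coe_norm_int, map_intCast]
  rw [FractionalIdeal.absNorm_eq, hdd, map_div₀, map_natCast, map_intCast]
  have hmk : ((Algebra.norm ℤ (I.den : 𝓞 k) : ℤ) : k) ≠ 0 := by exact_mod_cast hm0
  rcases lt_or_gt_of_ne hm0 with hneg | hpos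
  · refine ⟨-1, Or.inr rfl, ?_⟩
    rw [abs_of_neg hneg]
    push_cast
    field_simp
  · refine ⟨1, Or.inl rfl, ?_⟩
    rw [abs_of_pos hpos]
    push_cast
    field_simp

/-- `σ` restricted to `𝓞 k` is surjective (it is an involution). [folklore] -/
private theorem mapRingHom_conj_surjective :
    Function.Surjective
      (RingOfIntegers.mapRingHom (((conj ℚ k : k ≃ₐ[ℚ] k) : k →ₐ[ℚ] k) : k →+* k)) := by
  intro y
  refine ⟨RingOfIntegers.mapRingHom (((conj ℚ k : k ≃ₐ[ℚ] k) : k →ₐ[ℚ] k) : k →+* k) y, ?_⟩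
  apply RingOfIntegers.ext
  simp [conj_conj]

/-- **(P1)** `N(𝔞)⁻¹ σ(x) y ∈ 𝓞_k` for `x, y ∈ 𝔞` — i.e. `σ(𝔞) · 𝔞 ⊆ N(𝔞) 𝓞_k`, from `J σ(J) = (N J)` (the fractional
form of `𝔞 σ(𝔞) = (N𝔞)` in a quadratic field; ED. 2: public, for the `n = 1` lattices `L_{0,𝔞}` of KR (3.1)).
[cite: NeukirchANT1999, Ch. I §2 Prop. (2.6) (iii)] -/
theorem exists_int_eq_absNorm_inv_mul (𝔞 : (FractionalIdeal (𝓞 k)⁰ k)ˣ) {x y : k}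
    (hx : x ∈ (𝔞 : FractionalIdeal (𝓞 k)⁰ k)) (hy : y ∈ (𝔞 : FractionalIdeal (𝓞 k)⁰ k)) :
    ∃ o : 𝓞 k, (o : k) =
      (algebraMap ℚ k (FractionalIdeal.absNorm (𝔞 : FractionalIdeal (𝓞 k)⁰ k)))⁻¹ * conj ℚ k x * y := by
  classical
  set I : FractionalIdeal (𝓞 k)⁰ k := (𝔞 : FractionalIdeal (𝓞 k)⁰ k) with hI
  set σr : k →+* k := (((conj ℚ k : k ≃ₐ[ℚ] k) : k →ₐ[ℚ] k) : k →+* k) with hσr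
  have hI0 : I ≠ 0 := Units.ne_zero 𝔞
  obtain ⟨jx, hjx, hjx'⟩ := exists_num_of_mem I hx
  obtain ⟨jy, hjy, hjy'⟩ := exists_num_of_mem I hy
  obtain ⟨ε, hε, hN⟩ := absNorm_mul_den_mul_conj_den 𝔞
  -- `jy · σ(jx) ∈ J σJ = (N J)`
  have hmem : jy * RingOfIntegers.mapRingHom σr jx ∈ Ideal.span {((Ideal.absNorm I.num : ℕ) : 𝓞 k)} := by
    rw [← mul_map_conj_eq_span_absNorm I.num]
    exact Ideal.mul_mem_mul hjy (Ideal.mem_map_of_mem _ hjx)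
  obtain ⟨o, ho⟩ := Ideal.mem_span_singleton'.mp hmem
  have ho' : (o : k) * ((Ideal.absNorm I.num : ℕ) : k) = (jy : k) * conj ℚ k (jx : k) := by
    have := congrArg (fun z : 𝓞 k => (z : k)) ho
    simpa [hσr] using this
  have hd0 : ((I.den : 𝓞 k) : k) ≠ 0 := by
    exact_mod_cast nonZeroDivisors.coe_ne_zero I.den
  have hσd0 : conj ℚ k ((I.den : 𝓞 k) : k) ≠ 0 := by
    rwa [map_ne_zero_iff _ (conj ℚ k).injective]
  have hN0 : algebraMap ℚ k (FractionalIdeal.absNorm I) ≠ 0 := by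
    rw [map_ne_zero_iff _ (algebraMap ℚ k).injective, Ne, FractionalIdeal.absNorm_eq_zero_iff]
    exact hI0
  have hε2 : (ε : k) * ε = 1 := by
    rcases hε with rfl | rfl <;> norm_num
  rw [hjx', hjy', map_mul] at ho'
  -- `N · (ε o) · dσd = σx · y · dσd`
  have hmul : algebraMap ℚ k (FractionalIdeal.absNorm I) * ((ε : k) * o) *
      (((I.den : 𝓞 k) : k) * conj ℚ k ((I.den : 𝓞 k) : k)) =
      conj ℚ k x * y * (((I.den : 𝓞 k) : k) * conj ℚ k ((I.den : 𝓞 k) : k)) := by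
    linear_combination ((ε : k) * o) * hN + ((o : k) * ((Ideal.absNorm I.num : ℕ) : k)) * hε2 + ho'
  have h2 : algebraMap ℚ k (FractionalIdeal.absNorm I) * ((ε : k) * o) = conj ℚ k x * y :=
    mul_right_cancel₀ (mul_ne_zero hd0 hσd0) hmul
  refine ⟨(ε : 𝓞 k) * o, ?_⟩
  push_cast
  calc ((ε : k) * o)
      = (algebraMap ℚ k (FractionalIdeal.absNorm I))⁻¹ *
          (algebraMap ℚ k (FractionalIdeal.absNorm I) * ((ε : k) * o)) := by
        rw [← mul_assoc, inv_mul_cancel₀ hN0, one_mul]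
    _ = (algebraMap ℚ k (FractionalIdeal.absNorm I))⁻¹ * conj ℚ k x * y := by rw [h2, mul_assoc]

/-- **(P2)** `N(𝔞) σ(y) ∈ 𝔞` for `y ∈ 𝔞⁻¹` — i.e. `σ(𝔞⁻¹) ⊆ N(𝔞)⁻¹ 𝔞`, from `(N J) ⊆ J σ(J)` (the fractional form of
`𝔞 σ(𝔞) = (N𝔞)` in a quadratic field; ED. 2: public, for the `n = 1` lattices `L_{0,𝔞}` of KR (3.1)).
[cite: NeukirchANT1999, Ch. I §2 Prop. (2.6) (iii)] -/
theorem absNorm_mul_conj_mem (𝔞 : (FractionalIdeal (𝓞 k)⁰ k)ˣ) {y : k}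
    (hy : y ∈ (𝔞 : FractionalIdeal (𝓞 k)⁰ k)⁻¹) :
    algebraMap ℚ k (FractionalIdeal.absNorm (𝔞 : FractionalIdeal (𝓞 k)⁰ k)) * conj ℚ k y ∈
      (𝔞 : FractionalIdeal (𝓞 k)⁰ k) := by
  classical
  set I : FractionalIdeal (𝓞 k)⁰ k := (𝔞 : FractionalIdeal (𝓞 k)⁰ k) with hI
  set σr : k →+* k := (((conj ℚ k : k ≃ₐ[ℚ] k) : k →ₐ[ℚ] k) : k →+* k) with hσr
  have hI0 : I ≠ 0 := Units.ne_zero 𝔞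
  rw [FractionalIdeal.mem_inv_iff hI0] at hy
  obtain ⟨ε, hε, hN⟩ := absNorm_mul_den_mul_conj_den 𝔞
  have hd0 : ((I.den : 𝓞 k) : k) ≠ 0 := by exact_mod_cast nonZeroDivisors.coe_ne_zero I.den
  have hσd0 : conj ℚ k ((I.den : 𝓞 k) : k) ≠ 0 := by rwa [map_ne_zero_iff _ (conj ℚ k).injective]
  -- `Q z`: `z σ(y) = d σ(d) w` with `w ∈ 𝔞`, for all `z ∈ J σJ`
  have hQ : ∀ z ∈ I.num * I.num.map (RingOfIntegers.mapRingHom σr),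
      ∃ w ∈ (I : Submodule (𝓞 k) k),
        (z : k) * conj ℚ k y = ((I.den : 𝓞 k) : k) * conj ℚ k ((I.den : 𝓞 k) : k) * w := by
    intro z hz
    refine Submodule.mul_induction_on hz ?_ ?_
    · intro j hj j'' hj''
      obtain ⟨j', hj', rfl⟩ := (Ideal.mem_map_iff_of_surjective _ mapRingHom_conj_surjective).mp hj''
      obtain ⟨xj, hxj, hxje⟩ := exists_mem_of_num I hj
      obtain ⟨xj', hxj', hxje'⟩ := exists_mem_of_num I hj'
      -- `y xj' ∈ 𝓞 k`
      obtain ⟨o, ho⟩ := (FractionalIdeal.mem_one_iff (S := (𝓞 k)⁰)).mp (hy xj' hxj')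
      refine ⟨(RingOfIntegers.mapRingHom σr o) • xj, Submodule.smul_mem _ _ hxj, ?_⟩
      have e1 : ((j * RingOfIntegers.mapRingHom σr j' : 𝓞 k) : k) = (j : k) * conj ℚ k (j' : k) := by
        simp only [RingOfIntegers.coe_eq_algebraMap, map_mul]; rfl
      have e2 : (RingOfIntegers.mapRingHom σr o) • xj = conj ℚ k (o : k) * xj := by
        rw [Algebra.smul_def]; rfl
      have ho' : conj ℚ k (o : k) = conj ℚ k y * conj ℚ k xj' := by
        rw [show ((o : 𝓞 k) : k) = algebraMap (𝓞 k) k o from rfl, ho, map_mul]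
      rw [e1, e2, ho', hxje, hxje', map_mul]
      ring
    · rintro z₁ z₂ ⟨w₁, hw₁, h₁⟩ ⟨w₂, hw₂, h₂⟩
      refine ⟨w₁ + w₂, add_mem hw₁ hw₂, ?_⟩
      push_cast
      rw [add_mul, h₁, h₂]
      ring
  -- apply `Q` to `z = N J ∈ (N J) = J σJ`
  have hn : ((Ideal.absNorm I.num : ℕ) : 𝓞 k) ∈ I.num * I.num.map (RingOfIntegers.mapRingHom σr) := by
    rw [mul_map_conj_eq_span_absNorm I.num]
    exact Ideal.mem_span_singleton_self _
  obtain ⟨w, hw, hnw⟩ := hQ _ hn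
  push_cast at hnw
  have hmul : algebraMap ℚ k (FractionalIdeal.absNorm I) * conj ℚ k y *
      (((I.den : 𝓞 k) : k) * conj ℚ k ((I.den : 𝓞 k) : k)) =
      (ε : k) * w * (((I.den : 𝓞 k) : k) * conj ℚ k ((I.den : 𝓞 k) : k)) := by
    linear_combination (conj ℚ k y) * hN + (ε : k) * hnw
  have h2 : algebraMap ℚ k (FractionalIdeal.absNorm I) * conj ℚ k y = (ε : k) * w :=
    mul_right_cancel₀ (mul_ne_zero hd0 hσd0) hmul
  rw [h2, show ((ε : k) * w) = (ε : 𝓞 k) • w by rw [Algebra.smul_def]; rfl]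
  exact Submodule.smul_mem _ _ hw

end KR14dual

open KR14dual in
/-- **[KudlaRapoport2013, §14 (arXiv v2 p. 51)] — DISCHARGED**: «there is an `O_k`-antilinear isomorphism `𝔡⁻¹𝔞 ⥲ 𝔞^∨`,
`a ↦ N(𝔞)⁻¹ (·, a)_k`, where `(x, y)_k = tr(x y^σ)` … and `𝔡⁻¹` is the inverse different» — (i) integrality of
`N(𝔞)⁻¹ tr(x a^σ)` on `𝔞 × 𝔡⁻¹𝔞`, (ii) bijectivity `𝔡⁻¹𝔞 → Hom_ℤ(𝔞, ℤ)`, exactly as typed in ★ `KR2013_14_dualIso`.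
[cite: KudlaRapoport2013, §14 (arXiv v2 p. 51)] -/
theorem KR2013_14_dualIso_holds : KR2013_14_dualIso := by
  intro k _ _ _ _ 𝔞
  dsimp only
  classical
  set I : FractionalIdeal (𝓞 k)⁰ k := (𝔞 : FractionalIdeal (𝓞 k)⁰ k) with hI
  have hI0 : I ≠ 0 := Units.ne_zero 𝔞
  set N : ℚ := FractionalIdeal.absNorm I with hN
  have hN0 : N ≠ 0 := by rw [hN, Ne, FractionalIdeal.absNorm_eq_zero_iff]; exact hI0
  set c : k := algebraMap ℚ k N with hc
  have hc0 : c ≠ 0 := by rw [hc, map_ne_zero_iff _ (algebraMap ℚ k).injective]; exact hN0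
  have hσc : conj ℚ k c = c := (conj ℚ k).commutes N
  have hdual : FractionalIdeal.dual ℤ ℚ (1 : FractionalIdeal (𝓞 k)⁰ k) * I =
      FractionalIdeal.dual ℤ ℚ I⁻¹ := (FractionalIdeal.dual_inv ℤ ℚ).symm
  -- `N⁻¹ Tr(x σa) = Tr(a · (c⁻¹ σ x))`
  have htr : ∀ a x : k, N⁻¹ * Algebra.trace ℚ k (x * conj ℚ k a) =
      Algebra.trace ℚ k (a * (c⁻¹ * conj ℚ k x)) := by
    intro a x
    have e : a * (c⁻¹ * conj ℚ k x) = N⁻¹ • (conj ℚ k x * a) := by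
      rw [Algebra.smul_def, map_inv₀, ← hc]; ring
    rw [e, LinearMap.map_smul, smul_eq_mul, ← trace_conj (x * conj ℚ k a), map_mul, conj_conj]
  refine ⟨?_, ?_⟩
  · -- (i) integrality of `N⁻¹ Tr(x σa)` for `a ∈ 𝔡⁻¹𝔞 = (𝔞⁻¹)^∨`, `x ∈ 𝔞`
    intro a ha x hx
    rw [hdual, FractionalIdeal.mem_dual (inv_ne_zero hI0)] at ha
    have hz : c⁻¹ * conj ℚ k x ∈ I⁻¹ := by
      rw [FractionalIdeal.mem_inv_iff hI0]
      intro y hy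
      obtain ⟨o, ho⟩ := exists_int_eq_absNorm_inv_mul 𝔞 hx hy
      rw [FractionalIdeal.mem_one_iff]
      exact ⟨o, ho⟩
    obtain ⟨m, hm⟩ := RingHom.mem_range.mp (ha _ hz)
    refine ⟨m, ?_⟩
    rw [htr, ← Algebra.traceForm_apply, ← hm, algebraMap_int_eq, eq_intCast]
  · -- (ii) every `f ∈ 𝔞^∨` is `N⁻¹ Tr(· σa)` for a unique `a ∈ 𝔡⁻¹𝔞`
    intro f
    set B : LinearMap.BilinForm ℚ k := Algebra.traceForm ℚ k with hB
    have hBnd : B.Nondegenerate := traceForm_nondegenerate ℚ k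
    set b := basisOfFractionalIdeal k 𝔞 with hb
    set bI := fractionalIdealBasis k I with hbIdef
    have hbI : ∀ i, ((bI i : I) : k) = b i := fun i => (basisOfFractionalIdeal_apply k 𝔞 i).symm
    set φ : k →ₗ[ℚ] ℚ := b.constr ℚ fun i => ((f (bI i) : ℤ) : ℚ) with hφdef
    have hφb : ∀ i, φ (b i) = ((f (bI i) : ℤ) : ℚ) := fun i => by
      rw [hφdef, Basis.constr_basis]
    -- `φ` extends `f`
    have hφ : ∀ x : I, φ (x : k) = ((f x : ℤ) : ℚ) := by
      intro x
      have : (φ.restrictScalars ℤ) ∘ₗ ((I : Submodule (𝓞 k) k).subtype.restrictScalars ℤ) =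
          (Algebra.linearMap ℤ ℚ) ∘ₗ f := by
        refine bI.ext fun i => ?_
        simp only [LinearMap.coe_comp, Function.comp_apply, LinearMap.coe_restrictScalars,
          Submodule.coe_subtype, Algebra.linearMap_apply, algebraMap_int_eq, eq_intCast]
        rw [← hφb i, ← hbI i]
      have := congrArg (fun g => g x) this
      simpa using this
    set c₀ : k := (B.toDual hBnd).symm φ with hc₀
    have hc₀' : ∀ v : k, Algebra.trace ℚ k (c₀ * v) = φ v := fun v => by
      rw [← Algebra.traceForm_apply]
      exact LinearMap.BilinForm.apply_toDual_symm_apply φ v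
    -- characterisation of the representing element
    have hchar : ∀ a' : k,
        (∀ x : I, ((f x : ℤ) : ℚ) = N⁻¹ * Algebra.trace ℚ k ((x : k) * conj ℚ k a')) →
          a' = c * conj ℚ k c₀ := by
      intro a' ha'
      have h1 : B.toDual hBnd (N⁻¹ • conj ℚ k a') = φ := by
        refine b.ext fun i => ?_
        rw [LinearMap.BilinForm.toDual_def, hB, Algebra.traceForm_apply, hφb, ha' (bI i), hbI,
          smul_mul_assoc, LinearMap.map_smul, smul_eq_mul, mul_comm (conj ℚ k a')]
      have h2 : N⁻¹ • conj ℚ k a' = c₀ := by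
        rw [hc₀, ← h1, LinearEquiv.symm_apply_apply]
      have h3 : conj ℚ k a' = c * c₀ := by
        rw [← h2, Algebra.smul_def, map_inv₀, ← hc, ← mul_assoc, mul_inv_cancel₀ hc0, one_mul]
      rw [← conj_conj a', h3, map_mul, hσc]
    refine ⟨c * conj ℚ k c₀, ⟨?_, ?_⟩, ?_⟩
    · -- membership in `𝔡⁻¹𝔞 = (𝔞⁻¹)^∨`
      rw [hdual, FractionalIdeal.mem_dual (inv_ne_zero hI0)]
      intro y hy
      have hmem : c * conj ℚ k y ∈ I := absNorm_mul_conj_mem 𝔞 hy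
      rw [Algebra.traceForm_apply, RingHom.mem_range]
      refine ⟨f ⟨c * conj ℚ k y, hmem⟩, ?_⟩
      have e : c * conj ℚ k c₀ * y = conj ℚ k (c₀ * (c * conj ℚ k y)) := by
        rw [map_mul, map_mul, hσc, conj_conj]; ring
      rw [e, trace_conj, hc₀', algebraMap_int_eq, eq_intCast]
      exact (hφ ⟨c * conj ℚ k y, hmem⟩).symm
    · -- the formula
      intro x
      have e : (x : k) * conj ℚ k (c * conj ℚ k c₀) = N • (c₀ * x) := by
        rw [map_mul, hσc, conj_conj, Algebra.smul_def, ← hc]; ring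
      rw [e, LinearMap.map_smul, smul_eq_mul, ← mul_assoc, inv_mul_cancel₀ hN0, one_mul, hc₀', hφ]
    · -- uniqueness
      rintro a' ⟨-, ha'⟩
      exact hchar a' ha'

end Literature.AlgebraicGeometry.ShimuraVarieties.KudlaRapoport2013.Sec14CaseNTwo

end
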